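import Literature.AlgebraicGeometry.Resolution.Lipman1969FormallySmoothBaseChange
import Literature.AlgebraicGeometry.Resolution.ExceptionalFibreConnected
import Literature.AlgebraicGeometry.Resolution.PrincipalizationToResolution
import Literature.AlgebraicGeometry.Resolution.RegularLocalRingsNormal
import Literature.AlgebraicGeometry.Morphisms.SteinFactorizationLocalCriterion
import Literature.AlgebraicGeometry.Motives.GoodReductionFormalFunctionsProofs
import Literature.AlgebraicGeometry.Motives.SteinFactorizationCurve
import Mathlib.RingTheory.RingHom.Flat
import HarnessLib

/-!
# Lipman 1969, Proposition (16.5), forward half (N): normality ascends along a local-étale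
# formally smooth base change of a two-dimensional local ring with a desingularization

Topic: `Literature/AlgebraicGeometry/Resolution`. PROVED sibling of the named-fact file
`Lipman1969FormallySmoothBaseChange` (`Lipman1969_16_1_ii`, `Lipman1969_16_5`): the direction
"`A` normal ⇒ `B` normal" of J. Lipman, *Rational singularities, with applications to algebraic
surfaces and unique factorization*, Publ. Math. IHÉS 36 (1969), Proposition (16.5) (p. 235; the
normality clause is already in Proposition (16.3), p. 233), in the special case typed there
(`A → B` local, flat, `𝔪_A B = 𝔪_B`, `κ(B)/κ(A)` separable algebraic, `dim A = dim B = 2`, `A`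
reduced with a desingularization), CONDITIONAL on Lemma (16.1) (ii) (`h161 : Lipman1969_16_1_ii`:
the base change `Z = Y ×_A Spec B → Spec B` of a desingularization `Y → Spec A` is a
desingularization of `B`). One application of a future `Lipman1969_16_1_ii_holds` makes it
unconditional. The binders are verbatim those of `Lipman1969_16_5` (so `IsReduced A` and the two
`ringKrullDim` hypotheses are carried although this direction does not use them).

## Proof (Lipman, p. 235 with p. 199 "`H⁰(Z, 𝒪_Z) = R` since `R` is normal")

Let `g : Y → Spec A` be a desingularization and `A` an integrally closed domain.
1. `Γ(Y, 𝒪_Y) = A` (`IsResolution.isIso_appTop`: `Γ(Y, 𝒪_Y)` is finite over `A`, EGA III 3.2.1,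
   and a domain inside `K(Y) = Frac A`).
2. `B` is flat over `A` and `Y` is quasi-compact and separated, so by flat base change of global
   sections (Stacks 02KH; `SteinFibre.isIso_appTop_pullback_snd_of_flat`)
   `Γ(Z, 𝒪_Z) = Γ(Y, 𝒪_Y) ⊗_A B = B` for `Z = Y ×_A Spec B`.
3. `Z` is regular (Lemma (16.1) (ii), the hypothesis `h161`), so its local rings are integrally
   closed domains (Matsumura 14.3, 19.4); `Z` is locally Noetherian (finite type over `B`) and
   connected, because its ring of global functions `B` is local and so has no idempotents other
   than `0, 1`; hence `Z` is irreducible (Görtz–Wedhorn I, Ex. 3.16), i.e. `Z` is a normal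
   integral scheme.
4. The ring of global sections of a normal integral scheme is an integrally closed domain; it is
   `B`.

Everything used is proved in the tree; the only hypothesis that is a named fact is `h161`.
No new definitions. This file does not prove resolution of singularities in any dimension or
characteristic and settles no summit statement.

## References

* J. Lipman, Publ. Math. IHÉS 36 (1969): Lemma (16.1) (p. 231), Prop. (16.3) (p. 233),
  Prop. (16.5) (p. 235), §1 (p. 199). [Lipman1969]
* The Stacks Project, Tag 02KH (flat base change of cohomology, here `H⁰`), Tag 0357/033M
  (normal schemes and their components). [StacksProject]
* U. Görtz, T. Wedhorn, *Algebraic Geometry I*, 2nd ed. (2020), Exercise 3.16. [GortzWedhorn2020]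
-/

noncomputable section

open CategoryTheory CategoryTheory.Limits AlgebraicGeometry TopologicalSpace IsLocalRing

universe u

namespace Literature.AlgebraicGeometry.Resolution

/-- **Lipman 1969, Proposition (16.5), forward half (N): "`A` normal ⇒ `B` normal"**, conditional
on Lemma (16.1) (ii) (`h161`). In the setting of `Lipman1969_16_5` — `A`, `B` Noetherian local,
`A → B` local and flat with `𝔪_A B = 𝔪_B` and `κ(B)/κ(A)` separable algebraic, `A` reduced,
`dim A = dim B = 2`, `Spec A` admitting a desingularization `g : Y → Spec A` — if `A` is an
integrally closed domain then so is `B`. Proof: `Γ(Y, 𝒪_Y) = A` (`A` normal, `g` proper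
birational), hence `Γ(Z, 𝒪_Z) = B` for `Z = Y ×_A Spec B` by flat base change; `Z` is regular by
(16.1) (ii) and connected since `B` is local, hence a normal integral scheme, whose ring of global
sections `B` is therefore an integrally closed domain.
[cite: Lipman1969, Proposition (16.5) (p. 235); Proposition (16.3) (p. 233)] -/
theorem Lipman1969_16_5_normal_mp_of_16_1_ii (h161 : Lipman1969_16_1_ii.{u}) :
    ∀ (A B : Type u) [CommRing A] [CommRing B] [IsNoetherianRing A] [IsNoetherianRing B]
    [IsLocalRing A] [IsLocalRing B] [Algebra A B] [IsLocalHom (algebraMap A B)] [Module.Flat A B],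
    IsReduced A →
    (maximalIdeal A).map (algebraMap A B) = maximalIdeal B →
    Algebra.IsSeparable (ResidueField A) (ResidueField B) →
    ringKrullDim A = 2 → ringKrullDim B = 2 →
    (∃ (Y : Scheme.{u}) (g : Y ⟶ Spec (.of A)), IsResolution g) →
      (IsDomain A ∧ IsIntegrallyClosed A) → (IsDomain B ∧ IsIntegrallyClosed B) := by
  intro A B _ _ _ _ _ _ _ _ _ hred hmax hsep _ _ hY hA
  obtain ⟨Y, g, hg⟩ := hY
  obtain ⟨hAdom, hAic⟩ := hA
  haveI := hAdom
  haveI := hAic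
  -- the base change `Z = Y ×_A Spec B → Spec B` is a desingularization of `B` (Lemma (16.1) (ii))
  obtain ⟨-, hres⟩ := h161 A B hred hmax hsep Y g hg
  set ι : Spec (CommRingCat.of B) ⟶ Spec (CommRingCat.of A) :=
    Spec.map (CommRingCat.ofHom (algebraMap A B))
  set Z : Scheme.{u} := pullback g ι
  set gB : Z ⟶ Spec (.of B) := pullback.snd g ι
  -- Step 1: `Γ(Y, 𝒪_Y) = A`
  haveI : IsIso g.appTop := hg.isIso_appTop
  -- Step 2: flat base change of global sections, `Γ(Z, 𝒪_Z) = B`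
  haveI : IsProper g := hg.isProper
  haveI : CompactSpace Y := QuasiCompact.compactSpace_of_compactSpace g
  haveI : QuasiSeparatedSpace Y := quasiSeparatedSpace_of_quasiSeparated g
  have hflat : (algebraMap A B).Flat := RingHom.flat_algebraMap_iff.mpr inferInstance
  haveI : IsIso gB.appTop :=
    Literature.AlgebraicGeometry.Morphisms.SteinFibre.isIso_appTop_pullback_snd_of_flat g
      (algebraMap A B) hflat
  let e : B ≃+* Γ(Z, ⊤) :=
    ((Scheme.ΓSpecIso (CommRingCat.of B)).symm ≪≫ asIso gB.appTop).commRingCatIsoToRingEquiv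
  -- Step 3: `Z` is regular, locally Noetherian and connected, hence a normal integral scheme
  have hreg : Scheme.IsRegular Z := hres.isRegular
  haveI : IsProper gB := hres.isProper
  haveI : IsLocallyNoetherian Z := LocallyOfFiniteType.isLocallyNoetherian gB
  have hdom : ∀ z : Z, IsDomain (Z.presheaf.stalk z) := fun z => by
    haveI := hreg z
    exact isDomain_of_isRegularLocalRing _
  have hnorm : ∀ z : Z, IsIntegrallyClosed (Z.presheaf.stalk z) := fun z => by
    haveI := hreg z
    exact isIntegrallyClosed_of_isRegularLocalRing _
  -- `Z` is non-empty: its ring of global functions `B` is non-trivial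
  haveI hZne : Nonempty Z := by
    by_contra hemp
    have htop : (⊤ : Z.Opens) = ⊥ := by
      ext z
      exact absurd ⟨z⟩ hemp
    haveI : Subsingleton Γ(Z, ⊤) :=
      CommRingCat.subsingleton_of_isTerminal (Z.sheaf.isTerminalOfEqEmpty (by simp [htop]))
    exact not_subsingleton B e.toEquiv.subsingleton
  -- `Z` is connected: an idempotent global function is an idempotent of the local ring `B`
  haveI : PreconnectedSpace Z := by
    refine Literature.AlgebraicGeometry.Motives.preconnectedSpace_of_isIdempotentElem Z
      fun c hc => ?_
    have hc' : IsIdempotentElem (e.symm c) := by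
      rw [IsIdempotentElem, ← map_mul, hc.eq]
    have hmul : e.symm c * (1 - e.symm c) = 0 := by
      rw [mul_sub, mul_one, hc'.eq, sub_self]
    rcases IsLocalRing.isUnit_or_isUnit_one_sub_self (e.symm c) with hu | hu
    · right
      have h1 : 1 - e.symm c = 0 := by
        simpa using (hu.mul_right_eq_zero).mp hmul
      have h2 : e.symm c = 1 := (sub_eq_zero.mp h1).symm
      simpa using congrArg e h2
    · left
      have h1 : e.symm c = 0 := by
        simpa using (hu.mul_left_eq_zero).mp hmul
      simpa using congrArg e h1
  haveI : ConnectedSpace Z := ⟨hZne⟩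
  haveI : IrreducibleSpace Z :=
    Literature.AlgebraicGeometry.Motives.irreducibleSpace_of_isDomain_stalk Z hdom
  haveI : IsReduced Z := hreg.isReduced
  haveI : IsIntegral Z := isIntegral_of_irreducibleSpace_of_isReduced Z
  -- Step 4: the global sections of the normal integral scheme `Z` form an integrally closed
  -- domain, and they are `B`
  haveI : Nonempty (⊤ : Z.Opens) := ⟨⟨hZne.some, trivial⟩⟩
  haveI : IsIntegrallyClosed Γ(Z, ⊤) :=
    Literature.AlgebraicGeometry.Motives.isIntegrallyClosed_sections_opens_of_isIntegrallyClosed_stalk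
      hnorm ⊤
  exact ⟨MulEquiv.isDomain Γ(Z, ⊤) e.toMulEquiv, IsIntegrallyClosed.of_equiv e.symm⟩

/-- CONSUMER SHAPE CHECK (proved, no new declaration): the forward half (N) gives exactly what the
W4.4 consumer `HomologicalConductorNoZenoMinimalityBaseChange.lean` extracts from
`h165 : Lipman1969_16_5` as `hnorm.mp ⟨inferInstance, inferInstance⟩` — for `S` a normal domain
and `π : X → Spec S` a desingularization, `Ŝ` is a normal domain. [folklore] -/
example (h161 : Lipman1969_16_1_ii.{u})
    (S Ŝ : Type u) [CommRing S] [CommRing Ŝ] [IsNoetherianRing S] [IsNoetherianRing Ŝ]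
    [IsLocalRing S] [IsLocalRing Ŝ] [Algebra S Ŝ] [IsLocalHom (algebraMap S Ŝ)] [Module.Flat S Ŝ]
    [IsDomain S] [IsIntegrallyClosed S]
    (hmax : (maximalIdeal S).map (algebraMap S Ŝ) = maximalIdeal Ŝ)
    [Algebra.IsSeparable (ResidueField S) (ResidueField Ŝ)] (h2 : ringKrullDim S = 2)
    (h2B : ringKrullDim Ŝ = 2) (X : Scheme.{u}) (π : X ⟶ Spec (.of S)) (hπ : IsResolution π) :
    IsDomain Ŝ ∧ IsIntegrallyClosed Ŝ :=
  Lipman1969_16_5_normal_mp_of_16_1_ii h161 S Ŝ inferInstance hmax inferInstance h2 h2B ⟨X, π, hπ⟩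
    ⟨inferInstance, inferInstance⟩

end Literature.AlgebraicGeometry.Resolution

end
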